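import Summits.QuantumFields.YangMills.Theorems.CentreWallReflectionSlabDefs
import Literature.Barriers.QuantumFields.CenterSymmetryBreakingByQuarks
import HarnessLib

/-!
# Slab decomposition of the four-torus Wilson weight, I: slab weights, slab actions, the centre twist
# (crux `CentreWallReflection.WallReflection` ⟨stmt-QuantumFields-23707⟩, line `birth`, stub `stub_instantiate`; planner ym-idea-4 g18)

Pointwise identities: the weights of the slab `[0,j]` and of the translated complementary slab add up to one, so the Wilson action splits as
`Σ_p c_p = S_{[0,j]} + S_{[0,n+1−j]} ∘ τ_j`; with the central insertion `z` on the stack of `(μ,ν)`-plaquettes at `x_μ = x_ν = 0` the TWISTED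
action splits as `S_{[0,j]} ∘ T_{z⁻¹} + S_{[0,n+1−j]} ∘ τ_j` (`T` = left multiplication by `z` on the slice-`0` `ν`-links of the stack; every other
slab plaquette contains zero or two such links with opposite orientations, `central_collect`).
HONEST FRAMING: lattice bookkeeping toward ONE crux of a draft route (fixed torus, finite lattice); nothing here proves the route's target
`MarginalTwistOnset.FixedTorusCriterionFailure`, any continuum statement, or the Yang–Mills mass gap.  THEOREMS ONLY (no `def`, no `sorry`),
standard axioms.  References: [cite: OsterwalderSeiler1978, §2]; [cite: tHooft1979]; E. T. Tomboulis, L. G. Yaffe, CMP 100 (1985) 313;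
[cite: Luscher1983, §2].
-/

set_option autoImplicit false

noncomputable section

open scoped BigOperators
open MeasureTheory Literature.MathematicalPhysics.QuantumFieldTheory

namespace Summit.QuantumFields.YangMills.Theorems.CentreWallReflection.Slab

variable {n : ℕ} {G : Type*} [Group G] {N : ℕ} (ρ : G →* Matrix (Fin N) (Fin N) ℂ)

/-! ## §1 `ZMod (n+1)` bookkeeping -/

/-- `val` of `t - j` for `j ≤ n`. -/
theorem val_sub_natCast (t : ZMod (n + 1)) {j : ℕ} (hj : j ≤ n) :
    (t - (j : ZMod (n + 1))).val = if j ≤ t.val then t.val - j else t.val + (n + 1) - j := by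
  have hjv : ((j : ZMod (n + 1))).val = j := by
    rw [ZMod.val_natCast]; exact Nat.mod_eq_of_lt (by omega)
  have ht : t.val < n + 1 := ZMod.val_lt t
  split_ifs with h
  · rw [ZMod.val_sub (by rw [hjv]; exact h), hjv]
  · push Not at h
    set u := t - (j : ZMod (n + 1)) with hu
    have hu' : t = u + (j : ZMod (n + 1)) := by rw [hu, sub_add_cancel]
    have huv : u.val < n + 1 := ZMod.val_lt u
    have key : t.val = (u.val + j) % (n + 1) := by rw [hu', ZMod.val_add, hjv]
    by_cases hlt : u.val + j < n + 1
    · rw [Nat.mod_eq_of_lt hlt] at key; omega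
    · push Not at hlt
      rw [Nat.mod_eq_sub_mod hlt, Nat.mod_eq_of_lt (by omega)] at key
      omega

section Geometry

variable (μ : Fin 4)

/-! ## §2 Translation and gluing -/

omit [Group G] in
/-- `translate_apply` (slab bookkeeping, see the module docstring). -/
@[simp] theorem translate_apply (j : ZMod (n + 1)) (W : GaugeConfig 4 (n + 1) G) (e : Edge 4 (n + 1)) :
    translate μ j W e = W (e.1 + Pi.single μ j, e.2) := rfl

/-- `plaqShift_symm_apply_fst` (slab bookkeeping, see the module docstring). -/
theorem plaqShift_symm_apply_fst (j : ZMod (n + 1)) (p : Plaquette 4 (n + 1)) :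
    ((plaqShift μ j).symm p).1 = p.1 - Pi.single μ j := rfl

/-- `shift_add_comm` (slab bookkeeping, see the module docstring). -/
theorem shift_add_comm (x : Site 4 (n + 1)) (i : Fin 4) (v : Site 4 (n + 1)) :
    (x + v).shift i = x.shift i + v := add_right_comm _ _ _

/-- Plaquette holonomies of a translated configuration. -/
theorem plaquetteHolonomy_translate (j : ZMod (n + 1)) (W : GaugeConfig 4 (n + 1) G) (x : Site 4 (n + 1)) (a b : Fin 4) :
    plaquetteHolonomy (translate μ j W) x a b = plaquetteHolonomy W (x + Pi.single μ j) a b := by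
  simp only [plaquetteHolonomy, translate_apply, shift_add_comm]

omit [Group G] in
/-- `glue_apply_slice0` (slab bookkeeping, see the module docstring). -/
theorem glue_apply_slice0 (j : ℕ) (U X A : GaugeConfig 4 (n + 1) G) {e : Edge 4 (n + 1)} (h2 : e.2 ≠ μ) (h0 : e.1 μ = 0) :
    glue μ j U X A e = X e := by
  unfold glue; rw [if_pos ⟨h2, h0⟩]

omit [Group G] in
/-- `glue_apply_sliceJ` (slab bookkeeping, see the module docstring). -/
theorem glue_apply_sliceJ (j : ℕ) (U X A : GaugeConfig 4 (n + 1) G) {e : Edge 4 (n + 1)} (h2 : e.2 ≠ μ)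
    (hj0 : (j : ZMod (n + 1)) ≠ 0) (hj : e.1 μ = (j : ZMod (n + 1))) :
    glue μ j U X A e = A (e.1 - Pi.single μ (j : ZMod (n + 1)), e.2) := by
  have h0 : ¬ (e.2 ≠ μ ∧ e.1 μ = 0) := fun h => hj0 (hj ▸ h.2.symm ▸ rfl)
  unfold glue; rw [if_neg h0, if_pos ⟨h2, hj⟩]

omit [Group G] in
/-- `glue_apply_other` (slab bookkeeping, see the module docstring). -/
theorem glue_apply_other (j : ℕ) (U X A : GaugeConfig 4 (n + 1) G) {e : Edge 4 (n + 1)}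
    (h : e.2 = μ ∨ (e.1 μ ≠ 0 ∧ e.1 μ ≠ (j : ZMod (n + 1)))) : glue μ j U X A e = U e := by
  unfold glue
  rcases h with h | ⟨h1, h2⟩
  · simp [h]
  · simp [h1, h2]

/-! ## §3 Plaquette costs, slab weights and slab actions -/

omit [Group G] in
/-- `isTemporal_iff` (slab bookkeeping, see the module docstring). -/
theorem isTemporal_iff (p : Plaquette 4 (n + 1)) : isTemporal μ p = true ↔ (p.2.1.1 = μ ∨ p.2.1.2 = μ) := by
  simp [isTemporal]

/-- `slabWeight_nonneg` (slab bookkeeping, see the module docstring). -/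
theorem slabWeight_nonneg (j : ℕ) (p : Plaquette 4 (n + 1)) : 0 ≤ slabWeight μ j p := by
  unfold slabWeight; split_ifs <;> norm_num

/-- `slabWeight_le_one` (slab bookkeeping, see the module docstring). -/
theorem slabWeight_le_one (j : ℕ) (p : Plaquette 4 (n + 1)) : slabWeight μ j p ≤ 1 := by
  unfold slabWeight; split_ifs <;> norm_num

/-- **The weights of the slab `[0,j]` and of the translated complementary slab add up to one.** -/
theorem slabWeight_add_compl {j : ℕ} (hj1 : 1 ≤ j) (hjn : j ≤ n) (p : Plaquette 4 (n + 1)) :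
    slabWeight μ j p + slabWeight μ (n + 1 - j) ((plaqShift μ (j : ZMod (n + 1))).symm p) = 1 := by
  have hval : (((plaqShift μ (j : ZMod (n + 1))).symm p).1 μ).val =
      if j ≤ (p.1 μ).val then (p.1 μ).val - j else (p.1 μ).val + (n + 1) - j := by
    rw [plaqShift_symm_apply_fst, Pi.sub_apply, Pi.single_eq_same, val_sub_natCast _ hjn]
  have htemp : isTemporal μ ((plaqShift μ (j : ZMod (n + 1))).symm p) = isTemporal μ p := rfl
  have ht : (p.1 μ).val < n + 1 := ZMod.val_lt _
  unfold slabWeight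
  simp only [htemp, hval]
  by_cases hT : isTemporal μ p = true
  · simp only [hT, if_true]
    split_ifs <;> norm_num <;> omega
  · simp only [hT]
    split_ifs <;> norm_num <;> omega

/-- **Splitting of the Wilson action** into the slab `[0,j]` and the translated complementary slab:
`Σ_p c_p(W) = S_{[0,j]}(W) + S_{[0,n+1−j]}(τ_j W)`. -/
theorem sum_plaqCost_eq_slab_add {j : ℕ} (hj1 : 1 ≤ j) (hjn : j ≤ n) (W : GaugeConfig 4 (n + 1) G) :
    ∑ p : Plaquette 4 (n + 1), plaqCost ρ W p =
      slabAction ρ μ j W + slabAction ρ μ (n + 1 - j) (translate μ (j : ZMod (n + 1)) W) := by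
  unfold slabAction
  have hre : ∑ p : Plaquette 4 (n + 1), slabWeight μ (n + 1 - j) p * plaqCost ρ (translate μ (j : ZMod (n + 1)) W) p =
      ∑ p : Plaquette 4 (n + 1), slabWeight μ (n + 1 - j) ((plaqShift μ (j : ZMod (n + 1))).symm p) * plaqCost ρ W p := by
    rw [← Equiv.sum_comp (plaqShift μ (j : ZMod (n + 1))).symm]
    refine Finset.sum_congr rfl fun p _ => ?_
    congr 1
    simp only [plaqCost, plaquetteHolonomy_translate, plaqShift_symm_apply_fst, sub_add_cancel]
    rfl
  rw [hre, ← Finset.sum_add_distrib]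
  refine Finset.sum_congr rfl fun p _ => ?_
  rw [← add_mul, slabWeight_add_compl μ hj1 hjn, one_mul]

/-! ## §4 The centre twist on the slice-`0` links of the stack -/

variable (ν : Fin 4)

/-- `stackConfig_apply` (slab bookkeeping, see the module docstring). -/
@[simp] theorem stackConfig_apply (z : G) (e : Edge 4 (n + 1)) :
    stackConfig μ ν z e = if e.2 = ν ∧ e.1 μ = 0 ∧ e.1 ν = 0 then z else 1 := rfl

/-- `twistMap_apply` (slab bookkeeping, see the module docstring). -/
theorem twistMap_apply (z : G) (W : GaugeConfig 4 (n + 1) G) (e : Edge 4 (n + 1)) :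
    twistMap μ ν z W e = (if e.2 = ν ∧ e.1 μ = 0 ∧ e.1 ν = 0 then z else 1) * W e := rfl

/-- `twistMap_twistMap` (slab bookkeeping, see the module docstring). -/
theorem twistMap_twistMap (z w : G) (W : GaugeConfig 4 (n + 1) G) :
    twistMap μ ν z (twistMap μ ν w W) = twistMap μ ν (z * w) W := by
  funext e; simp only [twistMap_apply]; split_ifs <;> simp [mul_assoc]

/-- `twistMap_one` (slab bookkeeping, see the module docstring). -/
theorem twistMap_one (W : GaugeConfig 4 (n + 1) G) : twistMap μ ν (1 : G) W = W := by
  funext e; simp [twistMap_apply]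

/-- `stackConfig_mem_center` (slab bookkeeping, see the module docstring). -/
theorem stackConfig_mem_center {z : G} (hz : z ∈ Subgroup.center G) (e : Edge 4 (n + 1)) :
    stackConfig μ ν z e ∈ Subgroup.center G := by
  simp only [stackConfig_apply]; split_ifs; exacts [hz, Subgroup.one_mem _]

variable {μ ν}

/-- Plaquette holonomies are multiplicative against a central-valued left factor. -/
theorem plaquetteHolonomy_central_mul {c : GaugeConfig 4 (n + 1) G} (hc : ∀ e, c e ∈ Subgroup.center G)
    (W : GaugeConfig 4 (n + 1) G) (x : Site 4 (n + 1)) (a b : Fin 4) :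
    plaquetteHolonomy (c * W) x a b = plaquetteHolonomy c x a b * plaquetteHolonomy W x a b := by
  simp only [plaquetteHolonomy, Pi.mul_apply]
  exact Literature.Barriers.QuantumFields.central_collect (hc _) (hc _) (hc _) _ _ _ _

/-- The holonomy of the stack configuration: `z⁻¹` on the stack plaquettes `(x; μ, ν)`, `x_μ = x_ν = 0`, and `1` on every other
plaquette `(x; a, b)`, `a < b`, unless `(a, b) = (μ, ν)` and `x_μ = −1`, `x_ν = 0` (a layer-`n` plaquette). -/
theorem plaquetteHolonomy_stackConfig (hn : 1 ≤ n) (hμν : μ < ν) (z : G) (x : Site 4 (n + 1)) {a b : Fin 4} (hab : a < b)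
    (hlast : ¬ (a = μ ∧ b = ν ∧ x μ + 1 = 0)) :
    plaquetteHolonomy (stackConfig μ ν z) x a b = if a = μ ∧ b = ν ∧ x μ = 0 ∧ x ν = 0 then z⁻¹ else 1 := by
  have hμν' : μ ≠ ν := ne_of_lt hμν
  have one_ne : (1 : ZMod (n + 1)) ≠ 0 := by
    haveI : Fact (1 < n + 1) := ⟨by omega⟩
    exact one_ne_zero
  simp only [plaquetteHolonomy, stackConfig_apply, Site.shift, Pi.add_apply]
  by_cases hbν : b = ν
  · subst hbν
    by_cases haμ : a = μ
    · subst haμ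
      simp only [Pi.single_eq_same, Pi.single_eq_of_ne hμν', Pi.single_eq_of_ne hμν'.symm, add_zero, hμν', false_and,
        if_false, true_and, one_mul, inv_one, mul_one]
      have hl : ¬ (x a + 1 = 0 ∧ x b = 0) := fun h => hlast ⟨rfl, rfl, h.1⟩
      rw [if_neg hl, one_mul]
      by_cases hx : x a = 0 ∧ x b = 0
      · rw [if_pos hx, if_pos hx]
      · rw [if_neg hx, if_neg hx, inv_one]
    · have haν : a ≠ b := ne_of_lt hab
      simp only [Pi.single_eq_of_ne (Ne.symm haμ), Pi.single_eq_of_ne haν.symm, add_zero, haν,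
        false_and, if_false, one_mul, inv_one, mul_one, haμ]
      by_cases hx : x μ = 0 ∧ x b = 0
      · simp [hx]
      · simp [hx]
  · by_cases haν : a = ν
    · subst haν
      have hbμ : b ≠ μ := fun h => by rw [h] at hab; exact lt_asymm hab hμν
      have hba : b ≠ a := ne_of_gt hab
      simp only [Pi.single_eq_of_ne hbμ.symm, Pi.single_eq_of_ne hba.symm, Pi.single_eq_of_ne hμν', add_zero, hbν,
        false_and, if_false, true_and, mul_one, inv_one, (ne_of_gt hμν), and_false]
      by_cases hx : x μ = 0 ∧ x a = 0
      · simp [hx]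
      · simp [hx]
    · simp [haν, hbν]

/-- **The twisted cost is the untwisted cost of the inversely twisted configuration** on every plaquette of positive slab weight
(`1 ≤ j ≤ n`, `q = (μ, ν)`, `z` central). -/
theorem slabWeight_mul_plaqCost_twistMap (hn : 1 ≤ n) {q : {p : Fin 4 × Fin 4 // p.1 < p.2}} (hμ : q.1.1 = μ) (hν : q.1.2 = ν)
    {z : G} (hz : z ∈ Subgroup.center G) {j : ℕ} (hjn : j ≤ n)
    (W : GaugeConfig 4 (n + 1) G) (p : Plaquette 4 (n + 1)) :
    slabWeight μ j p * plaqCost ρ (twistMap μ ν z⁻¹ W) p = slabWeight μ j p * twistedCost ρ q z W p := by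
  have hμν : μ < ν := by rw [← hμ, ← hν]; exact q.2
  obtain ⟨x, ⟨⟨a, b⟩, hab⟩⟩ := p
  by_cases hw : slabWeight μ j (x, ⟨(a, b), hab⟩) = 0
  · rw [hw, zero_mul, zero_mul]
  -- not the last layer
  have hlast : ¬ (a = μ ∧ b = ν ∧ x μ + 1 = 0) := by
    rintro ⟨rfl, rfl, h⟩
    apply hw
    have hval : (x a).val = n := by
      have : x a = -1 := eq_neg_of_add_eq_zero_left h
      rw [this, ZMod.val_neg_one]
    have hT : isTemporal a (x, ⟨(a, b), hab⟩) = true := (isTemporal_iff a _).mpr (Or.inl rfl)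
    have hlt : ¬ ((x, (⟨(a, b), hab⟩ : {p : Fin 4 × Fin 4 // p.1 < p.2})).1 a).val < j := by simp only; omega
    unfold slabWeight
    rw [if_pos hT, if_neg hlt]
  congr 1
  simp only [plaqCost, twistedCost, twistMap]
  rw [plaquetteHolonomy_central_mul (stackConfig_mem_center μ ν (Subgroup.inv_mem _ hz)),
    plaquetteHolonomy_stackConfig hn hμν z⁻¹ x hab hlast, inv_inv]
  congr 4
  have hq : ((⟨(a, b), hab⟩ : {p : Fin 4 × Fin 4 // p.1 < p.2}) = q) ↔ (a = μ ∧ b = ν) := by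
    constructor
    · intro h; exact ⟨by rw [← hμ, ← h], by rw [← hν, ← h]⟩
    · rintro ⟨rfl, rfl⟩; exact Subtype.ext (Prod.ext hμ.symm hν.symm)
  simp only [hq, hμ, hν, and_assoc]

/-- **Slab action of the inversely twisted configuration = twisted slab action.** -/
theorem slabAction_twistMap (hn : 1 ≤ n) {q : {p : Fin 4 × Fin 4 // p.1 < p.2}} (hμ : q.1.1 = μ) (hν : q.1.2 = ν)
    {z : G} (hz : z ∈ Subgroup.center G) {j : ℕ} (hjn : j ≤ n) (W : GaugeConfig 4 (n + 1) G) :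
    slabAction ρ μ j (twistMap μ ν z⁻¹ W) = ∑ p : Plaquette 4 (n + 1), slabWeight μ j p * twistedCost ρ q z W p := by
  unfold slabAction
  exact Finset.sum_congr rfl fun p _ => slabWeight_mul_plaqCost_twistMap ρ hn hμ hν hz hjn W p

/-- The complementary slab does not see the twist: the twisted and untwisted costs agree on plaquettes of positive complementary
weight (the stack is in layer `0`, of complementary weight `0`). -/
theorem slabWeight_compl_mul_twistedCost {q : {p : Fin 4 × Fin 4 // p.1 < p.2}} (hμ : q.1.1 = μ)
    (z : G) {j : ℕ} (hj1 : 1 ≤ j) (hjn : j ≤ n) (W : GaugeConfig 4 (n + 1) G) (p : Plaquette 4 (n + 1)) :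
    slabWeight μ (n + 1 - j) ((plaqShift μ (j : ZMod (n + 1))).symm p) * twistedCost ρ q z W p =
      slabWeight μ (n + 1 - j) ((plaqShift μ (j : ZMod (n + 1))).symm p) * plaqCost ρ W p := by
  by_cases hst : p.2 = q ∧ p.1 q.1.1 = 0 ∧ p.1 q.1.2 = 0
  · -- a stack plaquette: temporal, layer 0, complementary weight 0
    have hw : slabWeight μ (n + 1 - j) ((plaqShift μ (j : ZMod (n + 1))).symm p) = 0 := by
      have hT : isTemporal μ ((plaqShift μ (j : ZMod (n + 1))).symm p) = true :=
        (isTemporal_iff μ _).mpr (Or.inl (by rw [← hμ]; exact congrArg (fun s => s.1.1) hst.1))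
      have hval : (((plaqShift μ (j : ZMod (n + 1))).symm p).1 μ).val = n + 1 - j := by
        rw [plaqShift_symm_apply_fst, Pi.sub_apply, Pi.single_eq_same, val_sub_natCast _ hjn]
        have : (p.1 μ).val = 0 := by rw [← hμ, hst.2.1, ZMod.val_zero]
        rw [this]; simp only [nonpos_iff_eq_zero]; rw [if_neg (by omega)]; omega
      unfold slabWeight; rw [if_pos hT, hval, if_neg (lt_irrefl _)]
    rw [hw, zero_mul, zero_mul]
  · simp only [twistedCost, plaqCost, if_neg hst, one_mul]

/-- **Splitting of the TWISTED Wilson action**: `Σ_p c^z_p(W) = S_{[0,j]}(T_{z⁻¹} W) + S_{[0,n+1−j]}(τ_j W)`. -/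
theorem sum_twistedCost_eq_slab_add (hn : 1 ≤ n) {q : {p : Fin 4 × Fin 4 // p.1 < p.2}} (hμ : q.1.1 = μ) (hν : q.1.2 = ν)
    {z : G} (hz : z ∈ Subgroup.center G) {j : ℕ} (hj1 : 1 ≤ j) (hjn : j ≤ n) (W : GaugeConfig 4 (n + 1) G) :
    ∑ p : Plaquette 4 (n + 1), twistedCost ρ q z W p =
      slabAction ρ μ j (twistMap μ ν z⁻¹ W) + slabAction ρ μ (n + 1 - j) (translate μ (j : ZMod (n + 1)) W) := by
  rw [slabAction_twistMap ρ hn hμ hν hz hjn]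
  unfold slabAction
  have hre : ∑ p : Plaquette 4 (n + 1), slabWeight μ (n + 1 - j) p * plaqCost ρ (translate μ (j : ZMod (n + 1)) W) p =
      ∑ p : Plaquette 4 (n + 1), slabWeight μ (n + 1 - j) ((plaqShift μ (j : ZMod (n + 1))).symm p) * twistedCost ρ q z W p := by
    rw [← Equiv.sum_comp (plaqShift μ (j : ZMod (n + 1))).symm]
    refine Finset.sum_congr rfl fun p _ => ?_
    rw [slabWeight_compl_mul_twistedCost ρ hμ z hj1 hjn]
    congr 1
    simp only [plaqCost, plaquetteHolonomy_translate, plaqShift_symm_apply_fst, sub_add_cancel]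
    rfl
  rw [hre, ← Finset.sum_add_distrib]
  refine Finset.sum_congr rfl fun p _ => ?_
  rw [← add_mul, slabWeight_add_compl μ hj1 hjn, one_mul]

end Geometry

end Summit.QuantumFields.YangMills.Theorems.CentreWallReflection.Slab

end
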